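import Summits.CriticalPhenomena.CardyFormulaZ2.Theorems.CardySelfRefinementLagHandOffEastDictionary
import HarnessLib

/-!
# The lattice dictionary at a ROW cross-cut approached from ABOVE (three quarter turns of the
column dictionary)
(groundwork for stub `stub_tournamentTransfer`, line `hitting-tournament`, crux `LagHandOff`,
stmt-CriticalPhenomena-10268; registered sub-goal stub `stub_tournamentTransfer_rowDictionary`)

Third quarter turn of the exact lattice dictionary "first arrival of the bond-`ℤ²` medial
exploration at a straight cross-cut = extreme cross-cut site of the open cluster of the arc `A`
grown on the near side" (Holden–Sun, arXiv:1905.13207, Prop. 6.25 (1), for G02's medial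
exploration of bond percolation on `δℤ²`, Smirnov 2001 §2).  The tree has it for columns from
the west (`stub_tournamentTransfer_columnDictionary`), rows from below (`columnDictionary_rot`,
`…BelowDictionary`) and columns from the east (`belowDictionary_rot`, `…EastDictionary`).  Here:

* `eastDictionary_rot` — the third generic transport step: the column-from-the-east dictionary
  for data `E` gives the row-from-ABOVE dictionary for the turned data `E'` (`E'.Ω = i·E.Ω`,
  same mesh, turned arcs); the column `{re = m}` becomes the row `{im = m}`;
* `stub_tournamentTransfer_rowDictionary` — the registered sub-goal: data on a Dobrushin domain
  are the quarter turn of the data turned thrice, these of the data turned twice, these of the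
  data turned once, which live on a Dobrushin domain (`exists_rot_data_three`) and so satisfy
  the column dictionary (`columnDictionary_of_carrier`); transport three times.

References: S. Smirnov, C. R. Acad. Sci. Paris 333 (2001), §2; G. Grimmett, *Percolation*
(1999), §1.6 (lattice symmetries), §11.2; N. Holden, X. Sun, arXiv:1905.13207, Prop. 6.25.
-/

noncomputable section

open Set
open Literature.Probability.Percolation Literature.Probability.LatticeModels
open Literature.Probability.RandomPlanarGeometry

namespace Summit.CriticalPhenomena.CardyFormulaZ2.Cruxes.LagHandOff.HittingTournament

/-! ### The third transport step: columns from the east ⟹ rows from above -/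

section Data

variable {E E' : DiscreteDobrushin}
  (hΩ : E'.Ω = (fun z => Complex.I * z) '' E.Ω) (hδ : E'.δ = E.δ)
  (hA : E'.arcA = (fun z => Complex.I * z) '' E.arcA)
  (hB : E'.arcB = (fun z => Complex.I * z) '' E.arcB)

include hΩ hδ hA hB

/-- **The third transport step: column-from-the-east dictionary for `E` ⟹ row-from-above
dictionary for the turned data `E'`.**  Along `x ↦ rotCell x` one has `(rotCell x) 1 = x 0`,
so the column `{re = m}` approached from the east is carried onto the row `{im = m}` approached
from above, the half-plane `{2m < x 0 + y 0}` of edges onto `{2m < x 1 + y 1}`, the unit vector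
`cornerUnit 1` onto `cornerUnit 2` and `cornerUnit 3` onto `cornerUnit 0 = e₀`; restricted open
connections, the graph `Ω_δ` and the exploration are transported by
`relabel_inter_mem_openConnIn_iff`, `adj_rot_iff`, `medialExploration_rot`.
[cite: Smirnov2001, §2] -/
theorem eastDictionary_rot (hE : E.IsZdAdmissible)
    (hEd : ∀ (c₀ : Site 2 × Fin 4) (ω : BondConfig (Site 2)) (m : ℤ), E.IsStartCorner c₀ →
      m < c₀.1 0 → (∃ e ∈ medialExploration E ω, ∀ x y : Site 2, e = s(x, y) → x 0 + y 0 ≤ 2 * m) →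
      ∃ (τ : ℕ) (v : Site 2), τ + 2 < (medialExploration E ω).length ∧ v 0 = m ∧
        (medialExploration E ω)[τ + 2]? = some s(v, v + cornerUnit 1) ∧
        (∀ i < τ + 2, ∀ x y : Site 2, (medialExploration E ω)[i]? = some s(x, y) →
          2 * m < x 0 + y 0) ∧
        E.bcBondConfig ω ∩ {e | ∀ x y : Site 2, e = s(x, y) → 2 * m < x 0 + y 0} ∈
          openConnIn {u : Site 2 | m ≤ u 0} c₀.1 v ∧
        ∀ w : Site 2, w 0 = m → v 1 < w 1 →
          (∀ z : Site 2, z 0 = m → v 1 < z 1 → z 1 ≤ w 1 →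
            (discreteDomainGraph E.Ω E.δ).Adj z (z + cornerUnit 3)) →
          ∀ S : Set (Site 2), E.bcBondConfig ω ∩
            {e | ∀ x y : Site 2, e = s(x, y) → 2 * m < x 0 + y 0} ∉ openConnIn S c₀.1 w)
    (c₀ : Site 2 × Fin 4) (ω : BondConfig (Site 2)) (m : ℤ) (hc₀ : E'.IsStartCorner c₀)
    (hside : m < c₀.1 1)
    (hfar : ∃ e ∈ medialExploration E' ω, ∀ x y : Site 2, e = s(x, y) → x 1 + y 1 ≤ 2 * m) :
    ∃ (τ : ℕ) (v : Site 2), τ + 2 < (medialExploration E' ω).length ∧ v 1 = m ∧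
      (medialExploration E' ω)[τ + 2]? = some s(v, v + cornerUnit 2) ∧
      (∀ i < τ + 2, ∀ x y : Site 2, (medialExploration E' ω)[i]? = some s(x, y) →
        2 * m < x 1 + y 1) ∧
      E'.bcBondConfig ω ∩ {e | ∀ x y : Site 2, e = s(x, y) → 2 * m < x 1 + y 1} ∈
        openConnIn {u : Site 2 | m ≤ u 1} c₀.1 v ∧
      ∀ w : Site 2, w 1 = m → w 0 < v 0 →
        (∀ z : Site 2, z 1 = m → w 0 ≤ z 0 → z 0 < v 0 →
          (discreteDomainGraph E'.Ω E'.δ).Adj z (z + Pi.single 0 1)) →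
        ∀ S : Set (Site 2), E'.bcBondConfig ω ∩
          {e | ∀ x y : Site 2, e = s(x, y) → 2 * m < x 1 + y 1} ∉ openConnIn S c₀.1 w := by
  -- adapted from `columnDictionary_rot` of `…BelowDictionary` (two more quarter turns)
  -- pull the start corner and the configuration back to `E`
  obtain ⟨a', d'⟩ := c₀
  obtain ⟨a, rfl⟩ := rotCell.surjective a'
  obtain ⟨d, rfl⟩ : ∃ d, d + 1 = d' := ⟨d' + 3, fin4_add_three_add_one d'⟩
  obtain ⟨ω₀, rfl⟩ := (BondConfig.relabel (sym2Equiv rotCell)).surjective ω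
  have hc : E.IsStartCorner (a, d) := (isStartCorner_rot_iff hΩ hδ hA hB (a, d)).1 hc₀
  have hmE := medialExploration_rot hΩ hδ hA hB hE hc ω₀
  have hside' : m < a 0 := by simpa using hside
  -- the set of edges strictly east of the column `{re = m}` is turned onto that strictly above
  -- the row `{im = m}`
  have hset : sym2Equiv rotCell '' {e | ∀ x y : Site 2, e = s(x, y) → 2 * m < x 0 + y 0} =
      {e | ∀ x y : Site 2, e = s(x, y) → 2 * m < x 1 + y 1} :=
    sym2Equiv_rot_image_setOf (fun x y => by simp) (fun x y h => by omega) (fun x y h => by omega)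
  have hpre : rotCell ⁻¹' {u : Site 2 | m ≤ u 1} = {u : Site 2 | m ≤ u 0} := by
    ext u; simp
  rw [hmE] at hfar ⊢
  -- the far medial vertex, pulled back
  have hfar₀ : ∃ e ∈ medialExploration E ω₀, ∀ x y : Site 2, e = s(x, y) → x 0 + y 0 ≤ 2 * m := by
    obtain ⟨e', he', hfar'⟩ := hfar
    obtain ⟨e, he, rfl⟩ := List.mem_map.1 he'
    refine ⟨e, he, fun x y hxy => ?_⟩
    have h := hfar' (rotCell x) (rotCell y) (by rw [hxy]; rfl)
    simpa using h
  obtain ⟨τ, v, hlen, hv, hhit, hbefore, hleft, hmin⟩ := hEd (a, d) ω₀ m hc hside' hfar₀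
  refine ⟨τ, rotCell v, ?_, ?_, ?_, ?_, ?_, ?_⟩
  · rwa [List.length_map]
  · simpa using hv
  · rw [List.getElem?_map, hhit, Option.map_some, sym2Equiv_mk, rotCell_add, rotCell_cornerUnit]
    rfl
  · intro i hi x' y' h
    obtain ⟨x, rfl⟩ := rotCell.surjective x'
    obtain ⟨y, rfl⟩ := rotCell.surjective y'
    rw [List.getElem?_map, Option.map_eq_some_iff] at h
    obtain ⟨e, he, hexy⟩ := h
    have hexy' : e = s(x, y) := (sym2Equiv rotCell).injective (by rw [hexy]; rfl)
    have h := hbefore i hi x y (by rw [he, hexy'])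
    simpa using h
  · show _ ∈ openConnIn _ (rotCell a) (rotCell v)
    rw [bcBondConfig_rot hΩ hδ hA hB, relabel_inter_mem_openConnIn_iff _ _ _ hset, hpre]
    exact hleft
  · intro w' hw' hvw' hseg S
    obtain ⟨w, rfl⟩ := rotCell.surjective w'
    have hw : w 0 = m := by simpa using hw'
    have hvw : v 1 < w 1 := by
      simp only [rotCell_apply_zero] at hvw'
      omega
    have hseg₀ : ∀ z : Site 2, z 0 = m → v 1 < z 1 → z 1 ≤ w 1 →
        (discreteDomainGraph E.Ω E.δ).Adj z (z + cornerUnit 3) := by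
      intro z hz0 hz1 hz2
      have h := hseg (rotCell z) (by simpa using hz0)
        (by simp only [rotCell_apply_zero]; omega) (by simp only [rotCell_apply_zero]; omega)
      rw [show rotCell z + Pi.single 0 1 = rotCell (z + cornerUnit 3) by
        rw [rotCell_add, rotCell_cornerUnit]; rfl, adj_rot_iff hΩ hδ] at h
      exact h
    show _ ∉ openConnIn _ (rotCell a) (rotCell w)
    rw [bcBondConfig_rot hΩ hδ hA hB, relabel_inter_mem_openConnIn_iff _ _ _ hset]
    exact hmin w hw hvw hseg₀ _

end Data

/-! ### The registered sub-goal -/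

/-- **Registered sub-goal stub `stub_tournamentTransfer_rowDictionary`: the lattice dictionary at
a ROW cross-cut `{im = m}` approached from ABOVE, for admissible data on a Dobrushin domain.**
For a start corner strictly above the row (`m < c₀.1 1`) and an exploration that does not stay
in `{im > m}`: the FIRST medial vertex of the exploration on the row is the horizontal edge
`{v, v - e₀}` west of a row site `v` (all earlier ones lie in `{im > m}`); `v` is joined to the
`A`-end `c₀.1` of `e_a` by open edges of `{im > m}`; and no row site strictly WEST of `v` on the
same row segment of `Ω_δ` is so joined (Holden–Sun Prop. 6.25 (1) for the bond-`ℤ²` medial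
exploration, three quarter turns of the column-from-the-west case).  Proof: the data are the
quarter turn of the data turned thrice, these of the data turned twice, these of the data turned
once, which are admissible data on a Dobrushin domain (`exists_rot_data_three`) satisfying the
column dictionary (`columnDictionary_of_carrier`); transport by `columnDictionary_rot`,
`belowDictionary_rot`, `eastDictionary_rot`. [cite: Smirnov2001, §2] -/
theorem stub_tournamentTransfer_rowDictionary : ∀ (D : DobrushinDomain) (E : DiscreteDobrushin) (c₀ : Site 2 × Fin 4) (ω : BondConfig (Site 2)) (m : ℤ), E.Ω = D.carrier → E.IsZdAdmissible → E.IsStartCorner c₀ → m < c₀.1 1 → (∃ e ∈ medialExploration E ω, ∀ x y : Site 2, e = s(x, y) → x 1 + y 1 ≤ 2 * m) → ∃ (τ : ℕ) (v : Site 2), τ + 2 < (medialExploration E ω).length ∧ v 1 = m ∧ (medialExploration E ω)[τ + 2]? = some s(v, v + cornerUnit 2) ∧ (∀ i < τ + 2, ∀ x y : Site 2, (medialExploration E ω)[i]? = some s(x, y) → 2 * m < x 1 + y 1) ∧ E.bcBondConfig ω ∩ {e | ∀ x y : Site 2, e = s(x, y) → 2 * m < x 1 + y 1} ∈ openConnIn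 {u : Site 2 | m ≤ u 1} c₀.1 v ∧ ∀ w : Site 2, w 1 = m → w 0 < v 0 → (∀ z : Site 2, z 1 = m → w 0 ≤ z 0 → z 0 < v 0 → (discreteDomainGraph E.Ω E.δ).Adj z (z + Pi.single 0 1)) → ∀ S : Set (Site 2), E.bcBondConfig ω ∩ {e | ∀ x y : Site 2, e = s(x, y) → 2 * m < x 1 + y 1} ∉ openConnIn S c₀.1 w := by
  intro D E c₀ ω m hΩD hE hc₀ hside hfar
  obtain ⟨D₁, -, -, E₁, E₂, E₃, ⟨hΩ₁, hE₁⟩, ⟨-, hE₂⟩, ⟨-, hE₃⟩, -, ⟨h2Ω, h2δ, h2A, h2B⟩,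
    ⟨h3Ω, h3δ, h3A, h3B⟩, h4Ω, h4δ, h4A, h4B⟩ := exists_rot_data_three D hΩD hE
  exact eastDictionary_rot h4Ω h4δ h4A h4B hE₃
    (belowDictionary_rot h3Ω h3δ h3A h3B hE₂
      (columnDictionary_rot h2Ω h2δ h2A h2B hE₁ (columnDictionary_of_carrier D₁ hΩ₁ hE₁)))
    c₀ ω m hc₀ hside hfar

end Summit.CriticalPhenomena.CardyFormulaZ2.Cruxes.LagHandOff.HittingTournament

end
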